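import Literature.Barriers.CriticalPhenomena.LaceExpansionIsingAboveFourReduction
import Literature.Barriers.CriticalPhenomena.LaceExpansionXSpaceAsymptotics
import Mathlib.Analysis.SpecialFunctions.Artanh
import HarnessLib

/-!
# Sakai's Theorem 1.3 for the spread-out Ising model as "lace expansion + Gaussian
# deconvolution": the decomposition of `Sakai2007_thm13_spreadOut`

Barrier catalogue `Literature/Barriers/CriticalPhenomena/` (D-0021), third file of the barrier
`LaceExpansionIsingAboveFour` (`LaceExpansionIsingAboveFour.lean`: statement and named facts;
`…Proofs.lean`, `…Reduction.lean`: the two "bubble ⇒ `γ = 1`" conjuncts reduced to Aizenman's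
bound). This file decomposes the third conjunct, the named fact
`SpreadOutIsing.Sakai2007_thm13_spreadOut` — Sakai 2007, Theorem 1.3, spread-out case:
`G_{p_c}(x) = (A/τ(p_c)) a_d/(σ²|x|^{d-2}) (1 + O(|x|^{-(ρ∧2)+ε}))`, `ρ = 2(d-4) > 0`, `L ≫ 1` —
along the architecture of its printed proof, "Following the model-independent analysis of the
lace expansion in [h05, hhs03], we obtain the following asymptotics of the critical two-point
function" (Sakai 2007, §1.2), with the model-independent analysis taken in its modern form,
Liu–Slade 2026 (*Gaussian deconvolution and the lace expansion for spread-out models*,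
arXiv:2310.07640; "Applications include spread-out models of the Ising model … in dimensions
`d > 4`"; "Assumption 1.5 has been verified for large `L` in [HHS03, Saka07] with `ρ = 2(d-4)`
(self-avoiding walk, Ising)").

## The decomposition

* model-independent analysis (NAMED FACTS, pure analysis): `LiuSlade2026_prop12_greenBound`
  (Prop. 1.2: `S_1(x) ≤ δ_{0,x} + K_S L^{-(2-ε)}⟦x⟧^{-(d-2)}`) and `LiuSlade2026_thm17` (Thm. 1.7
  with its error display (1.21): under Assumptions 1.3 and 1.5, for `L ≥ L₂`,
  `G_{z_c}(x) = (λ/σ²)a_d/⟦x⟧^{d-2} + O_L(⟦x⟧^{-(d-2+s)})`, `λ = 1 + O(L^{-2+ε})`), stated over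
  explicit objects: the step distribution `soStep` (`D(x) = 1{0<‖x‖_∞≤L}/N_L`), its variance
  `soVariance`, the random-walk Green function `soGreen` (`S_μ = Σ_n μⁿD^{*n}`), the convolution
  `latticeConv`, and the assumption predicates `LSAssumptionG` (Assumption 1.3),
  `LSBootstrapLE` (`b(z) ≤ t`), `LSAssumptionH` (Assumption 1.5); `⟦x⟧`, `ℤ^d`-symmetry and
  `a_d` are the catalogue's `jnorm`, `IsZdSymmetric`, `gaussianAmp`
  (`LaceExpansionXSpaceAsymptotics.lean`);
* model-dependent inputs (NAMED FACTS, Sakai 2007): `Sakai2007_isingAssumptionH` — the Ising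
  lace expansion `G_p = Π_p + Π_p * τD * G_p` with the diagrammatic bounds
  `|Π_p(x) - δ_{o,x}| ≤ O(θ₀)δ_{o,x} + O(θ₀²)|x|^{-(d+2+ρ)}` under the bootstrap hypotheses
  (Prop. 1.1, Prop. 3.1, §3.1, (1.18); bounds as corrected in Sakai 2022), i.e. Assumption 1.5
  for the `z`-parametrised Ising family `isingFamily` (`z = τ = N_L tanh β`, `z_c = N_L tanh β_c`);
  `spreadOutTwoPoint_continuousOn_beta` (continuity of `G_β(x)` in `β ≤ β_c`, §3.1) and
  `spreadOutTwoPoint_le_soGreen` (the random-walk bound `G ≤ S_τ`, `τ ≤ 1`, §4.1 footnote);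
* PROVED: Liu–Slade's Assumption 1.3 for the Ising family (`lsAssumptionG_isingFamily`) from the
  tree — `z_c ≥ 1` (the finite-size criterion at `S = {0}`), `ℤ^d`-symmetry (graph automorphisms),
  `G ≥ 0` (GKS I), `Σ_x G_{z_c} = ∞` (`χ_{β_c} = ∞`), summability and `o(|x|^{-(d-2)})`-decay below
  `z_c` (`χ_β < ∞` and the exponential decay of `…Reduction.lean`), monotonicity (GKS II) — given
  the two facts for continuity and the random-walk bound; and the ASSEMBLY
  `Sakai2007_thm13_spreadOut_of_LS : N0 → N1 → N2 → (continuity) → (RW bound) →`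
  `Sakai2007_thm13_spreadOut` (choice `ρ = 2(d-4)`, `s = 2 - ε'`, `λ(L) ≥ ½` for large `L`).

* PROVED (Part F): the continuity fact itself, `spreadOutTwoPoint_continuousOn_beta_holds`
  (left-continuity from the monotone volume limit; right-Lipschitz bound
  `G_β(x) ≤ G_{β₀}(x) + (β-β₀)|J|χ_{β₁}` below `β_c` from the integrated Lebowitz inequality of
  `…Proofs.lean`), whence `lsAssumptionG_isingFamily'` and `Sakai2007_thm13_spreadOut_of_LS'` with
  the random-walk bound as the only classical input.

* CORRECTION (Part G): the `λ`-clause of `LiuSlade2026_thm17` ("`|λ(L) - 1| ≤ K L^{-(2-ε')}` for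
  every `ε' > 0`") over-states the printed "`λ_{z_c} = 1 + O(L^{-2+ε})`", whose `ε` is the one
  fixed in §1.2.2 and carried by Assumptions 1.4–1.5; as stated it is false (the family
  `G_z = S_{z/z_c}/z_c`, `z_c = 1 + L^{-2+ε}`, see the docstring). `LiuSlade2026_thm1_7` is the
  same statement with that clause at the fixed `ε`; `LiuSlade2026_thm1_7_of_thm17` (old ⇒ new)
  and the re-threaded assemblies `Sakai2007_thm13_spreadOut_of_thm1_7{,'}` are proved.

What remains for `Sakai2007_thm13_spreadOut_holds` is exactly: the two Liu–Slade analysis facts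
(formalizable Fourier analysis on `𝕋^d`; Theorem 1.7 in the form `LiuSlade2026_thm1_7`), Sakai's
expansion-with-bounds (a theory), and the random-walk bound (with the transience of the
spread-out walk in `d > 2`).

## References

* A. Sakai, *Lace expansion for the Ising model*, Comm. Math. Phys. 272 (2007) 283–344,
  arXiv:math-ph/0510093: §1.2 (Prop. 1.1; (1.15) the uniformly spread-out `J`; Prop. 1.2;
  `τ`, `D(x) = τ_{o,x}/τ`, `σ²`; (1.18) `G_p = Π_p + Π_p*τD*G_p`; (1.19) `S_r = Σ_i rⁱD^{*i}`;
  Theorem 1.3), §3.1 (Prop. 3.1 and the sketch proof of Prop. 1.2: (3.2)–(3.6); "τ and G(x) are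
  nondecreasing and continuous in `p ≤ p_c`"), §4.1 (footnote: the random-walk bound
  `⟨φ_oφ_x⟩_Λ ≤ S_τ(x)`, `τ ≤ 1`) [Sakai2007]. A. Sakai, Comm. Math. Phys. 392 (2022) 783–823
  (corrected diagrammatic bounds) [Sakai2022].
* Y. Liu, G. Slade, *Gaussian deconvolution and the lace expansion for spread-out models*,
  Ann. Inst. H. Poincaré Probab. Statist. (2026), arXiv:2310.07640: Def. 1.1, (1.6)–(1.8),
  Prop. 1.2 with (1.10), Assumption 1.3, (1.12) (bootstrap function), Assumption 1.5 with
  (1.17)–(1.18), Prop. 1.6, Theorem 1.7 with (1.20)–(1.21), (1.22)–(1.23) [LiuSlade2026] (all equation numbers are those of the arXiv versions held in the literature store); Y. Liu, G. Slade,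
  *Gaussian deconvolution and the lace expansion*, Probab. Theory Related Fields (2024),
  Thm. 1.2 [LiuSlade2024].
-/

noncomputable section

namespace Literature.Barriers.CriticalPhenomena.SpreadOutIsing

open MeasureTheory Filter Topology Finset Literature.Probability.LatticeModels
open Literature.Probability.Percolation (signedPerm_mem_box_iff)
open scoped ENNReal BigOperators

variable {d L : ℕ}

/-! ## Part A. The spread-out random walk and the `z`-parametrised Ising family -/

/-- The Kronecker delta `δ_{0,x}` on `ℤ^d`. [cite: Sakai2007, §1.2 (notation δ_{o,x})] -/
def delta0 (x : Site d) : ℝ := if x = 0 then 1 else 0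

/-- `δ_{0,0} = 1`. [folklore] -/
@[simp] theorem delta0_zero : delta0 (0 : Site d) = 1 := if_pos rfl

/-- `δ_{0,x} = 0` for `x ≠ 0`. [folklore] -/
theorem delta0_of_ne_zero {x : Site d} (hx : x ≠ 0) : delta0 x = 0 := if_neg hx

/-- `0 ≤ δ_{0,x} ≤ 1`. [folklore] -/
theorem delta0_nonneg (x : Site d) : 0 ≤ delta0 x := by
  unfold delta0; split_ifs <;> norm_num

/-- Sakai's normalisation `N_L = Σ_{z ∈ ℤ^d} 1{0 < ‖z‖_∞ ≤ L} = (2L+1)^d - 1`, the number of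
neighbours of the origin in the range-`L` graph. [cite: Sakai2007, §1.2, (1.15) (uniformly spread-out interaction)] -/
def soCount (d L : ℕ) : ℕ := (spreadOutGraph d L).degree 0

/-- The one-step distribution of the spread-out random walk,
`D(x) = τ_{o,x}/τ = 1{0 < ‖x‖_∞ ≤ L}/N_L` (Sakai 2007, §1.2: `D(x) = τ_{o,x}/τ` with the
uniformly spread-out `J` of (1.15); Liu–Slade 2026, Def. 1.1 with `v` the normalised indicator of
the punctured cube). [cite: Sakai2007, §1.2 (D(x) = τ_{o,x}/τ) and (1.15)] [cite: LiuSlade2026, Def. 1.1] -/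
def soStep (d L : ℕ) (x : Site d) : ℝ :=
  if (spreadOutGraph d L).Adj 0 x then ((soCount d L : ℝ))⁻¹ else 0

/-- The variance `σ² = Σ_x |x|² D(x)` of the step distribution (`|x|` Euclidean).
[cite: Sakai2007, §1.2 (σ² = Σ_x |x|²D(x))] [cite: LiuSlade2026, §1.2.1 (σ²)] -/
def soVariance (d L : ℕ) : ℝ :=
  ∑ x ∈ (spreadOutGraph d L).neighborFinset 0, euclidNorm x ^ 2 * ((soCount d L : ℝ))⁻¹

/-- Convolution on `ℤ^d`: `(f * g)(x) = Σ_{y ∈ ℤ^d} f(y) g(x - y)` (a `tsum`; the junk value `0`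
if the family is not summable — below it is applied to a finitely supported or absolutely
summable factor). Written in the source's form rather than through Mathlib's fibre-indexed
`DiscreteConvolution.addConvolution` (extensionally the same operation, but without the
iterated-sum API used here) so that the displayed identities `G = h + zD * h * G` match the text
symbol by symbol. [cite: Sakai2007, §1.2 ((f*g)(x) = Σ_y f(y)g(x-y))] -/
def latticeConv (f g : Site d → ℝ) (x : Site d) : ℝ := ∑' y : Site d, f y * g (x - y)

/-- Convolution powers `f^{*n}`, `f^{*0} = δ`. [cite: Sakai2007, §1.2 (f^{*i} = f^{*(i-1)} * f, f^{*0} = δ)] -/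
def convPow (f : Site d → ℝ) : ℕ → Site d → ℝ
  | 0 => delta0
  | n + 1 => latticeConv (convPow f n) f

/-- The spread-out random-walk Green function `S_μ(x) = Σ_{n ≥ 0} μⁿ D^{*n}(x)` (Sakai 2007,
(1.19); the solution of `(δ - μD) * S_μ = δ`, Liu–Slade 2026, (1.6)–(1.7)). A real `tsum`
(junk value `0` where the series diverges, i.e. for `μ = 1` in the recurrent dimensions
`d ≤ 2`; the facts below use it for `d > 2`). [cite: Sakai2007, §1.2, (1.19)] [cite: LiuSlade2026, (1.6)–(1.7)] -/
def soGreen (d L : ℕ) (μ : ℝ) (x : Site d) : ℝ := ∑' n : ℕ, μ ^ n * convPow (soStep d L) n x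

/-- Sakai's parameter `τ = τ(p) = Σ_x tanh(pJ_{o,x}) = N_L tanh β` (in the normalisation of the
barrier file, `β = p/N_L`); this is the `z` of Liu–Slade's convolution equation
`G_z = h_z + zD * h_z * G_z`. [cite: Sakai2007, §1.2 (τ = Σ_x τ_{o,x}, τ_{x,y} = tanh(pJ_{x,y}))] [cite: LiuSlade2026, (1.17)] -/
def isingZ (d L : ℕ) (β : ℝ) : ℝ := soCount d L * Real.tanh β

/-- The inverse parametrisation `β(z) = artanh(z/N_L)` (so that `τ(β(z)) = z` for
`0 ≤ z < N_L`). [cite: Sakai2007, §1.2 (τ = Σ_x tanh(pJ_{o,x}))] -/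
def soBetaOfZ (d L : ℕ) (z : ℝ) : ℝ := Real.artanh (z / soCount d L)

/-- The critical value `z_c = τ(p_c) = N_L tanh β_c` of the parameter `z`.
[cite: Sakai2007, Theorem 1.3 (τ(p_c))] [cite: LiuSlade2026, Assumption 1.3 (z_c)] -/
def isingZc (d L : ℕ) : ℝ := isingZ d L (critBeta d L)

/-- The spread-out Ising two-point function in Liu–Slade's parametrisation,
`G_z(x) = G_{β(z)}(x)`, `z = N_L tanh β ∈ [0, N_L)`. [cite: LiuSlade2026, Assumption 1.3 (the family G_z)] [cite: Sakai2007, (1.18)] -/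
def isingFamily (d L : ℕ) (z : ℝ) (x : Site d) : ℝ := spreadOutTwoPoint d L (soBetaOfZ d L z) x

/-! ### Elementary API -/

/-- `e₁ = (1,0,…,0)` is a neighbour of the origin when `d, L ≥ 1`. [folklore] -/
theorem adj_zero_single (hd : 1 ≤ d) (hL : 1 ≤ L) :
    (spreadOutGraph d L).Adj 0 (Pi.single ⟨0, hd⟩ 1) := by
  rw [spreadOutGraph_adj_iff]
  refine ⟨fun h => ?_, fun i => ?_⟩
  · have := congrFun h ⟨0, hd⟩
    simp at this
  · have hL' : (1 : ℤ) ≤ L := by exact_mod_cast hL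
    by_cases hi : i = ⟨0, hd⟩
    · subst hi; simpa using hL'
    · simp [hi]

/-- `-e₁` is a neighbour of the origin when `d, L ≥ 1`. [folklore] -/
theorem adj_zero_neg_single (hd : 1 ≤ d) (hL : 1 ≤ L) :
    (spreadOutGraph d L).Adj 0 (-Pi.single ⟨0, hd⟩ 1) := by
  rw [spreadOutGraph_adj_iff]
  refine ⟨fun h => ?_, fun i => ?_⟩
  · have := congrFun h ⟨0, hd⟩
    simp at this
  · have hL' : (1 : ℤ) ≤ L := by exact_mod_cast hL
    by_cases hi : i = ⟨0, hd⟩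
    · subst hi; simpa using hL'
    · simp [hi]

/-- `N_L ≥ 2` for `d, L ≥ 1` (the origin has the distinct neighbours `± e₁`). [folklore] -/
theorem two_le_soCount (hd : 1 ≤ d) (hL : 1 ≤ L) : 2 ≤ soCount d L := by
  rw [soCount, ← SimpleGraph.card_neighborFinset_eq_degree]
  have hne : (Pi.single (⟨0, hd⟩ : Fin d) (1 : ℤ) : Site d) ≠ -Pi.single ⟨0, hd⟩ 1 := by
    intro h
    have := congrFun h ⟨0, hd⟩
    simp at this
  calc 2 = ({Pi.single (⟨0, hd⟩ : Fin d) (1 : ℤ), -Pi.single ⟨0, hd⟩ 1} : Finset (Site d)).card := by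
        rw [Finset.card_pair hne]
    _ ≤ ((spreadOutGraph d L).neighborFinset 0).card := by
        refine Finset.card_le_card fun x hx => ?_
        rw [SimpleGraph.mem_neighborFinset]
        rcases Finset.mem_insert.1 hx with rfl | hx
        · exact adj_zero_single hd hL
        · rw [Finset.mem_singleton.1 hx]; exact adj_zero_neg_single hd hL

/-- `N_L > 0` for `d, L ≥ 1`. [folklore] -/
theorem soCount_pos (hd : 1 ≤ d) (hL : 1 ≤ L) : 0 < soCount d L :=
  lt_of_lt_of_le (by norm_num) (two_le_soCount hd hL)

/-- `1 < N_L` as a real number, for `d, L ≥ 1`. [folklore] -/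
theorem one_lt_soCount_real (hd : 1 ≤ d) (hL : 1 ≤ L) : (1 : ℝ) < soCount d L := by
  have := two_le_soCount hd hL
  exact_mod_cast (lt_of_lt_of_le (by norm_num) this)

/-- `D ≥ 0`. [folklore] -/
theorem soStep_nonneg (x : Site d) : 0 ≤ soStep d L x := by
  unfold soStep; split_ifs <;> positivity

/-- `D` vanishes off the neighbourhood of the origin. [folklore] -/
theorem soStep_of_not_adj {x : Site d} (hx : ¬(spreadOutGraph d L).Adj 0 x) : soStep d L x = 0 :=
  if_neg hx

/-- `D` is a probability distribution: `Σ_x D(x) = 1` (as a finite sum over the neighbourhood of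
the origin), for `d, L ≥ 1`. [cite: LiuSlade2026, Def. 1.1] -/
theorem sum_soStep_eq_one (hd : 1 ≤ d) (hL : 1 ≤ L) :
    ∑ x ∈ (spreadOutGraph d L).neighborFinset 0, soStep d L x = 1 := by
  have hN : (soCount d L : ℝ) ≠ 0 := by exact_mod_cast (soCount_pos hd hL).ne'
  have : ∀ x ∈ (spreadOutGraph d L).neighborFinset 0, soStep d L x = ((soCount d L : ℝ))⁻¹ :=
    fun x hx => if_pos ((SimpleGraph.mem_neighborFinset _ _ _).1 hx)
  rw [Finset.sum_congr rfl this, Finset.sum_const, nsmul_eq_mul,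
    SimpleGraph.card_neighborFinset_eq_degree]
  show (soCount d L : ℝ) * ((soCount d L : ℝ))⁻¹ = 1
  exact mul_inv_cancel₀ hN

/-- `Σ_x D(x) = 1` as a series. [cite: LiuSlade2026, Def. 1.1] -/
theorem hasSum_soStep (hd : 1 ≤ d) (hL : 1 ≤ L) : HasSum (soStep d L) 1 := by
  rw [← sum_soStep_eq_one hd hL]
  exact hasSum_sum_of_ne_finset_zero fun x hx =>
    soStep_of_not_adj fun h => hx ((SimpleGraph.mem_neighborFinset _ _ _).2 h)

/-- The range-`L` graph is invariant under the signed coordinate permutations of `ℤ^d`.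
[folklore] -/
theorem spreadOutGraph_adj_signedPerm (π : Equiv.Perm (Fin d)) (ε : Fin d → ℤˣ) (x y : Site d) :
    (spreadOutGraph d L).Adj (Site.signedPerm π ε x) (Site.signedPerm π ε y) ↔
      (spreadOutGraph d L).Adj x y := by
  simp only [spreadOutGraph_adj_iff, (Site.signedPerm π ε).injective.ne_iff, Site.signedPerm_apply]
  refine and_congr_right fun _ => ⟨fun h i => ?_, fun h i => ?_⟩
  · have := h (π i)
    rw [Equiv.symm_apply_apply, ← mul_sub, abs_mul] at this
    rcases Int.units_eq_one_or (ε (π i)) with hε | hε <;> rw [hε] at this <;> simpa using this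
  · have := h (π.symm i)
    rw [← mul_sub, abs_mul]
    rcases Int.units_eq_one_or (ε i) with hε | hε <;> rw [hε] <;> simpa using this

/-- `D` is `ℤ^d`-symmetric. [cite: LiuSlade2026, Def. 1.1 (v is ℤ^d-symmetric)] -/
theorem isZdSymmetric_soStep : IsZdSymmetric (soStep d L) := by
  intro π ε x
  unfold soStep
  have h := spreadOutGraph_adj_signedPerm (L := L) π ε 0 x
  rw [Site.signedPerm_zero] at h
  simp only [h]

/-- `σ² > 0` for `d, L ≥ 1`. [cite: LiuSlade2026, §1.2.1 (σ² ≍ L²)] -/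
theorem soVariance_pos (hd : 1 ≤ d) (hL : 1 ≤ L) : 0 < soVariance d L := by
  have hN : (0 : ℝ) < soCount d L := by exact_mod_cast soCount_pos hd hL
  have hmem : (Pi.single (⟨0, hd⟩ : Fin d) (1 : ℤ) : Site d) ∈ (spreadOutGraph d L).neighborFinset 0 :=
    (SimpleGraph.mem_neighborFinset _ _ _).2 (adj_zero_single hd hL)
  have hterm : ∀ x ∈ (spreadOutGraph d L).neighborFinset 0,
      0 ≤ euclidNorm x ^ 2 * ((soCount d L : ℝ))⁻¹ := fun x _ => by positivity
  refine lt_of_lt_of_le ?_ (Finset.single_le_sum hterm hmem)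
  have h1 : 1 ≤ euclidNorm (Pi.single (⟨0, hd⟩ : Fin d) (1 : ℤ) : Site d) :=
    one_le_euclidNorm_of_ne_zero (by
      intro h; have := congrFun h ⟨0, hd⟩; simp at this)
  have : 0 < euclidNorm (Pi.single (⟨0, hd⟩ : Fin d) (1 : ℤ) : Site d) ^ 2 := by positivity
  exact mul_pos this (inv_pos.2 hN)

/-- `τ(β(z)) = z` for `0 ≤ z < N_L`: `tanh(artanh(z/N_L)) = z/N_L`. [folklore] -/
theorem isingZ_soBetaOfZ (hd : 1 ≤ d) (hL : 1 ≤ L) {z : ℝ} (hz0 : 0 ≤ z) (hz : z < soCount d L) :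
    isingZ d L (soBetaOfZ d L z) = z := by
  have hN : (0 : ℝ) < soCount d L := by exact_mod_cast soCount_pos hd hL
  unfold isingZ soBetaOfZ
  rw [Real.tanh_artanh ⟨by
    have : 0 ≤ z / soCount d L := div_nonneg hz0 hN.le
    linarith, (div_lt_one hN).2 hz⟩]
  field_simp

/-- `β(τ(β)) = β`: `artanh(tanh β) = β`. [folklore] -/
theorem soBetaOfZ_isingZ (hd : 1 ≤ d) (hL : 1 ≤ L) (β : ℝ) : soBetaOfZ d L (isingZ d L β) = β := by
  have hN : (soCount d L : ℝ) ≠ 0 := by exact_mod_cast (soCount_pos hd hL).ne'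
  unfold soBetaOfZ isingZ
  rw [mul_div_cancel_left₀ _ hN, Real.artanh_tanh]

/-- At `z = z_c` the family is the critical two-point function `G_{β_c}`. [cite: Sakai2007, Theorem 1.3] -/
theorem isingFamily_isingZc (hd : 1 ≤ d) (hL : 1 ≤ L) (x : Site d) :
    isingFamily d L (isingZc d L) x = spreadOutTwoPoint d L (critBeta d L) x := by
  rw [isingFamily, isingZc, soBetaOfZ_isingZ hd hL]

/-- `β(z) ≥ 0` for `z ≥ 0`. [folklore] -/
theorem soBetaOfZ_nonneg {z : ℝ} (hz : 0 ≤ z) : 0 ≤ soBetaOfZ d L z :=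
  Real.artanh_nonneg (div_nonneg hz (Nat.cast_nonneg _))

/-- `z < N_L` for `z ≤ z_c` (`tanh < 1`), `d, L ≥ 1`. [folklore] -/
theorem lt_soCount_of_le_isingZc (hd : 1 ≤ d) (hL : 1 ≤ L) {z : ℝ} (hz : z ≤ isingZc d L) :
    z < soCount d L := by
  have hN : (0 : ℝ) < soCount d L := by exact_mod_cast soCount_pos hd hL
  refine lt_of_le_of_lt hz ?_
  unfold isingZc isingZ
  have := Real.tanh_lt_one (critBeta d L)
  nlinarith

/-- `β(z)` is nondecreasing on `[0, N_L)`. [folklore] -/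
theorem soBetaOfZ_mono (hd : 1 ≤ d) (hL : 1 ≤ L) {z₁ z₂ : ℝ} (h0 : 0 ≤ z₁) (h12 : z₁ ≤ z₂)
    (h2 : z₂ < soCount d L) : soBetaOfZ d L z₁ ≤ soBetaOfZ d L z₂ := by
  have hN : (0 : ℝ) < soCount d L := by exact_mod_cast soCount_pos hd hL
  unfold soBetaOfZ
  refine Real.artanh_le_artanh ?_ ((div_lt_one hN).2 h2) (div_le_div_of_nonneg_right h12 hN.le)
  have : 0 ≤ z₁ / soCount d L := div_nonneg h0 hN.le
  linarith

/-- `artanh` is continuous on `(-1, 1)` (`artanh x = ½ log((1+x)/(1-x))`). [folklore] -/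
theorem continuousOn_artanh : ContinuousOn Real.artanh (Set.Ioo (-1) 1) := by
  have h : Set.EqOn Real.artanh (fun x => 1 / 2 * Real.log ((1 + x) / (1 - x))) (Set.Ioo (-1) 1) :=
    fun x hx => Real.artanh_eq_half_log ⟨hx.1.le, hx.2.le⟩
  refine ContinuousOn.congr ?_ h
  refine continuousOn_const.mul (ContinuousOn.log ?_ fun x hx => ?_)
  · exact (continuousOn_const.add continuousOn_id).div (continuousOn_const.sub continuousOn_id)
      fun x hx => by linarith [hx.2]
  · have h1 : 0 < 1 + x := by linarith [hx.1]
    have h2 : 0 < 1 - x := by linarith [hx.2]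
    exact (div_pos h1 h2).ne'

/-- `z ↦ β(z)` is continuous on `[0, N_L)`. [folklore] -/
theorem continuousOn_soBetaOfZ (hd : 1 ≤ d) (hL : 1 ≤ L) :
    ContinuousOn (soBetaOfZ d L) (Set.Ico 0 (soCount d L)) := by
  have hN : (0 : ℝ) < soCount d L := by exact_mod_cast soCount_pos hd hL
  have hfun : soBetaOfZ d L = Real.artanh ∘ fun z => z / (soCount d L : ℝ) := rfl
  rw [hfun]
  refine continuousOn_artanh.comp (continuousOn_id.div_const _) fun z hz => ⟨?_, ?_⟩
  · have : 0 ≤ z / (soCount d L : ℝ) := div_nonneg hz.1 hN.le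
    linarith
  · exact (div_lt_one hN).2 hz.2

/-! ## Part B. Liu–Slade's framework: assumptions and the deconvolution theorem (named facts) -/

/-- **"`b(z) ≤ t`"** for Liu–Slade's bootstrap function
`b(z) = max{ sup_{x ≠ 0} G_z(x) / (K_S L^{-2+ε}|x|^{-(d-2)}), 3(z - 1) }` ((1.12)), written out:
`G_z(x) ≤ t · K_S L^{-(2-ε)} |x|^{-(d-2)}` for all `x ≠ 0`, and `3(z - 1) ≤ t`. Used with
`t = 3` (the a priori bound under which the lace-expansion bounds are required) and, in
Liu–Slade's proof, with `t = 2` (the bootstrap output). [cite: LiuSlade2026, (1.12) (bootstrap function b)] -/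
def LSBootstrapLE (d L : ℕ) (ε K_S : ℝ) (Gz : Site d → ℝ) (z t : ℝ) : Prop :=
  (∀ x : Site d, x ≠ 0 →
      Gz x ≤ t * (K_S * (L : ℝ) ^ (-(2 - ε)) * euclidNorm x ^ (-((d : ℝ) - 2)))) ∧
    3 * (z - 1) ≤ t

/-- **Liu–Slade 2026, Assumption 1.3** on a family `G_z : ℤ^d → [0, ∞]`, `z ∈ [1, z_c]`
(`z_c ≥ 1`), of `ℤ^d`-symmetric functions, for the spread-out step distribution `D` of range
`L`: "(i) `Σ_x G_{z_c}(x) = ∞`; (ii) for each `z < z_c`, `Σ_x G_z(x) < ∞` and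
`G_z(x) = o(|x|^{-(d-2)})` as `|x| → ∞` (need not be uniform in `z`); (iii) for each `x`,
`G_z(x)` is non-decreasing and continuous in `z ∈ [1, z_c]`; (iv) `G_1(x) ≤ S_1(x)` for all
`x`." Transcription: the family is real-valued (finite — a restriction; for the Ising model
`G ≤ 1`), indexed by all reals with the conditions imposed on `[1, z_c]`; (i) for a nonnegative
function is "not summable"; `o(|x|^{-(d-2)})` is `G_z(x)|x|^{d-2} → 0` along the cofinite
filter. [cite: LiuSlade2026, Assumption 1.3] -/
structure LSAssumptionG (d L : ℕ) (G : ℝ → Site d → ℝ) (zc : ℝ) : Prop where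
  /-- `z_c ≥ 1`. -/
  one_le_zc : 1 ≤ zc
  /-- each `G_z` is `ℤ^d`-symmetric -/
  symm : ∀ z ∈ Set.Icc 1 zc, IsZdSymmetric (G z)
  /-- `G_z ≥ 0` -/
  nonneg : ∀ z ∈ Set.Icc 1 zc, ∀ x, 0 ≤ G z x
  /-- (i) `Σ_x G_{z_c}(x) = ∞` -/
  not_summable_crit : ¬Summable (G zc)
  /-- (ii), first half: `Σ_x G_z(x) < ∞` for `z < z_c` -/
  summable_subcrit : ∀ z ∈ Set.Ico 1 zc, Summable (G z)
  /-- (ii), second half: `G_z(x) = o(|x|^{-(d-2)})` for `z < z_c` -/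
  decay_subcrit : ∀ z ∈ Set.Ico 1 zc,
    Tendsto (fun x => G z x * euclidNorm x ^ ((d : ℝ) - 2)) cofinite (𝓝 0)
  /-- (iii), monotonicity in `z` -/
  monotoneOn : ∀ x, MonotoneOn (fun z => G z x) (Set.Icc 1 zc)
  /-- (iii), continuity in `z` -/
  continuousOn : ∀ x, ContinuousOn (fun z => G z x) (Set.Icc 1 zc)
  /-- (iv) the random-walk bound at `z = 1` -/
  le_green : ∀ x, G 1 x ≤ soGreen d L 1 x

/-- **Liu–Slade 2026, Assumption 1.5 (inhomogeneous lace expansion)**, at spread-out level `L`,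
with parameters `ε` (the small exponent), `K_S` (the constant of the bootstrap function),
`ρ`, `K_h`, and `η_L` standing for the value at `L` of the printed `o(1)` ("`o(1) → 0` uniformly
in `z` and `x` as `L → ∞`"; the user supplies `η : ℕ → ℝ` with `η_L → 0` and this predicate at
each `L`): "If `b(z) ≤ 3` then there exists a `ℤ^d`-symmetric function `h_z : ℤ^d → ℝ` for which
`G_z = h_z + zD * h_z * G_z`, and
`|h_z(x) - δ_{0,x}| ≤ K_h L^{-2+ε}(δ_{0,x} + o(1)/⟦x⟧^{d+2+ρ})` (`x ∈ ℤ^d`), where the constant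
`K_h` is independent of `z` and `L`." The convolution `zD * h_z * G_z` is written
`z · (D * (h_z * G_z))` with the `tsum` convolution `latticeConv` (`D` is finitely supported and
`h_z * G_z` is absolutely convergent under the stated bounds, so no junk value is involved); `⟦x⟧`
is `jnorm`. Imposed for `z ∈ [1, z_c]`. [cite: LiuSlade2026, Assumption 1.5 and (1.17)–(1.18)] -/
def LSAssumptionH (d L : ℕ) (ε K_S ρ K_h ηL : ℝ) (G : ℝ → Site d → ℝ) (zc : ℝ) : Prop :=
  ∀ z ∈ Set.Icc 1 zc, LSBootstrapLE d L ε K_S (G z) z 3 →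
    ∃ h : Site d → ℝ, IsZdSymmetric h ∧
      (∀ x, G z x = h x + z * latticeConv (soStep d L) (latticeConv h (G z)) x) ∧
      ∀ x, |h x - delta0 x| ≤
        K_h * (L : ℝ) ^ (-(2 - ε)) * (delta0 x + ηL / jnorm x ^ ((d : ℝ) + 2 + ρ))

/-- NAMED FACT — **Liu–Slade 2026, Proposition 1.2 (spread-out Green function), second display:**
"Let `d > 2`, `ε > 0`, and `L ≥ L₀`. … there is a constant `K_S = K_S(ε)` such that
`S_1(x) ≤ δ_{0,x} + K_S L^{-(2-ε)} ⟦x⟧^{-(d-2)}` (`x ∈ ℤ^d`)", with `L₀` depending on `d` and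
the step profile `v` only (§1.2.1, "Large `L` assumption"), here for the punctured-cube step
distribution `D(x) = 1{0 < ‖x‖_∞ ≤ L}/N_L` of Sakai's uniformly spread-out model (`soStep`, an
instance of Def. 1.1) and `S_1 = Σ_n D^{*n}` (`soGreen d L 1`). `K_S > 0` is recorded explicitly
(it is forced: `S_1(e₁) ≥ D(e₁) > 0`). Pure random-walk analysis (Appendix A of the source),
not proved here. Transcription note: `L₀` is quantified after `ε` (it may depend on `ε`), weaker than the printed `L₀ = L₀(d, v)`; this is the shape consumed by `LiuSlade2026_thm17`. [cite: LiuSlade2026, Proposition 1.2, (1.10)] -/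
def LiuSlade2026_prop12_greenBound : Prop :=
  ∀ d : ℕ, 2 < d → ∀ ε : ℝ, 0 < ε → ∃ K_S : ℝ, 0 < K_S ∧ ∃ L₀ : ℕ, ∀ L : ℕ, L₀ ≤ L →
    ∀ x : Site d, soGreen d L 1 x ≤
      delta0 x + K_S * (L : ℝ) ^ (-(2 - ε)) * jnorm x ^ (-((d : ℝ) - 2))

/-- MISSTATED — superseded by `LiuSlade2026_thm1_7` (Part G below): the `λ`-clause of this
declaration, "`|λ(L) - 1| ≤ K L^{-(2-ε')}` for EVERY `ε' > 0`", quantifies a fresh `ε'`, whereas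
the printed "`λ_{z_c} = 1 + O(L^{-2+ε})`" is at the `ε` fixed in §1.2.2 and carried by the
hypotheses; as stated this Prop is false (counter-family in the docstring of
`LiuSlade2026_thm1_7`). Kept verbatim because tree theorems take it as a hypothesis; new work
should use `LiuSlade2026_thm1_7`. Original description follows.

NAMED FACT — **Liu–Slade 2026, Theorem 1.7 with its error display (1.21)** (the Gaussian
deconvolution theorem for spread-out models with an inhomogeneous lace expansion): "Let `d > 4`.
Under Assumption 1.3, together with … Assumption 1.5, there is an `L₂` such that for all
`L ≥ L₂`, `G_{z_c}(x) ∼ (λ_{z_c}/σ²) a_d/|x|^{d-2}` as `|x| → ∞`, where `a_d` is the constant of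
(1.8), and, for any fixed `ε > 0`, `λ_{z_c} = 1 + O(L^{-2+ε})`", and "That theorem
[Liu–Slade 2024, Thm. 1.2] then immediately improves (1.20) with an explicit error term:
`G_{z_c}(x) = (λ_{z_c}/σ²) a_d/⟦x⟧^{d-2} + O_L(1)/⟦x⟧^{d-2+s}` with any
`s < ρ ∧ 2 ∧ (ρ - (d-8)/2)`." Transcription choices (conservative): the data are an `L`-indexed
sequence of families `G^{(L)}_z` with critical values `z_c(L)` (the assumptions' constants being
uniform in `L`, their `o(1)` a sequence `η_L → 0`); "fix a small `ε > 0`" (§1.2.2) is rendered as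
`∃ ε₀ > 0, ∀ ε ∈ (0, ε₀]`; the constant `K_S` of the bootstrap function is any positive constant
for which the bound (1.10) of Prop. 1.2 holds for all large `L` (the only property of `K_S` the
proof uses); `λ_{z_c} = λ(L)` with `|λ(L) - 1| ≤ K L^{-(2-ε')}` for every `ε' > 0`; `f ∼ g` with
`g = c|x|^{2-d}`, `c ≠ 0`, as `f(x)|x|^{d-2} → c` along the cofinite filter; `a_d = gaussianAmp d`,
`σ² = soVariance d L`, `⟦x⟧ = jnorm x`. Pure analysis (§§2–4 and Appendix A of the source, with
Liu–Slade 2024), not proved here. [cite: LiuSlade2026, Theorem 1.7 and (1.21)] [cite: LiuSlade2024, Theorem 1.2] -/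
def LiuSlade2026_thm17 : Prop :=
  ∀ d : ℕ, 4 < d → ∀ ρ : ℝ, max (((d : ℝ) - 8) / 2) 0 < ρ →
    ∃ ε₀ : ℝ, 0 < ε₀ ∧ ∀ ε : ℝ, 0 < ε → ε ≤ ε₀ → ∀ K_S : ℝ, 0 < K_S →
      (∃ L₀ : ℕ, ∀ L : ℕ, L₀ ≤ L → ∀ x : Site d, soGreen d L 1 x ≤
          delta0 x + K_S * (L : ℝ) ^ (-(2 - ε)) * jnorm x ^ (-((d : ℝ) - 2))) →
      ∀ (G : ℕ → ℝ → Site d → ℝ) (zc : ℕ → ℝ) (K_h : ℝ) (η : ℕ → ℝ),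
        Tendsto η atTop (𝓝 0) →
        (∃ L₁ : ℕ, ∀ L : ℕ, L₁ ≤ L →
            LSAssumptionG d L (G L) (zc L) ∧ LSAssumptionH d L ε K_S ρ K_h (η L) (G L) (zc L)) →
        ∃ L₂ : ℕ, ∃ lam : ℕ → ℝ,
          (∀ ε' : ℝ, 0 < ε' → ∃ K : ℝ, ∀ L : ℕ, L₂ ≤ L →
              |lam L - 1| ≤ K * (L : ℝ) ^ (-(2 - ε'))) ∧
          ∀ L : ℕ, L₂ ≤ L →
            Tendsto (fun x : Site d => G L (zc L) x * euclidNorm x ^ ((d : ℝ) - 2)) cofinite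
                (𝓝 (lam L * gaussianAmp d / soVariance d L)) ∧
            ∀ s : ℝ, s < min (min ρ 2) (ρ - ((d : ℝ) - 8) / 2) → ∃ K : ℝ, ∀ x : Site d,
              |G L (zc L) x - lam L * gaussianAmp d / (soVariance d L * jnorm x ^ ((d : ℝ) - 2))| ≤
                K / jnorm x ^ ((d : ℝ) - 2 + s)

/-! ## Part C. The model-dependent inputs (Sakai 2007): named facts -/

/-- NAMED FACT — **the Ising lace expansion with its diagrammatic bounds verifies Liu–Slade's
Assumption 1.5 for the spread-out model in `d > 4`, with `ρ = 2(d-4)`** (Sakai 2007, Prop. 1.1,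
Prop. 3.1 and the sketch proof of Prop. 1.2 in §3.1, with (1.18); the diagrammatic bounds as
corrected in Sakai 2022; this is how Liu–Slade state their Ising application: "Assumption 1.5 has
been verified for large `L` in [HHS03, Saka07] with `ρ = 2(d-4)` (self-avoiding walk, Ising)",
§1.2.2, (1.22)–(1.23)). Printed content: for the ferromagnetic spread-out model and `p ≤ p_c`,
under the bootstrap hypotheses "`τ ≤ 2`, `G(x) ≤ δ_{o,x} + θ₀⟦x⟧^{-q}`" with `q = d - 2 ∈ (d/2, d)`
(i.e. `d > 4`), `θ₀` sufficiently small and `θ₀L^{d-q}` bounded away from zero (Prop. 3.1) —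
here `θ₀ = 3K_S L^{-2+ε}`, which is what `b(z) ≤ 3` says — the expansion coefficients obey
`|Π_Λ^{(j)}(x) - δ_{o,x}| ≤ O(θ₀)δ_{o,x} + O(θ₀²)(1-δ_{o,x})|x|^{-(d+2+ρ)}`, `ρ = 2(d-4)`, uniformly in
`Λ` and `j` ((3.5)–(3.6)), whence the limit `Π_p` with
`G_p(x) = Π_p(x) + (Π_p * τD * G_p)(x)` and the same bound ((1.18)); in Liu–Slade's notation
`h_z = Π_p`, `z = τ = N_L tanh β`, `D(x) = τ_{o,x}/τ`, `K_h L^{-2+ε} = O(θ₀)`,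
`o(1) = O(θ₀²)/(K_h L^{-2+ε}) = O(L^{-2+ε}) → 0`; `ℤ^d`-symmetry of `Π_p` is that of the model.
Transcribed over `isingFamily`/`isingZc` (the two-point function `G_{β(z)}` of the barrier file and
`z_c = N_L tanh β_c`), for every small `ε` and every `K_S > 0`, with `L₁` allowed to depend on
`K_S` and `ε`. This is the sixty-page core of Sakai's paper (random-current lace expansion and
diagrammatic bounds); named fact, not proved here.
[cite: Sakai2007, Proposition 1.1, (1.18), Proposition 3.1 and §3.1 (sketch proof of Proposition 1.2, (3.4)–(3.6))]
[cite: Sakai2022, abstract and §1 (corrected diagrammatic bounds, same decay)]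
[cite: LiuSlade2026, §1.2.2, (1.22)–(1.23) (Assumption 1.5 verified for Ising with ρ = 2(d-4))] -/
def Sakai2007_isingAssumptionH : Prop :=
  ∀ d : ℕ, 4 < d → ∃ ε₁ : ℝ, 0 < ε₁ ∧ ∀ ε : ℝ, 0 < ε → ε ≤ ε₁ → ∀ K_S : ℝ, 0 < K_S →
    ∃ K_h : ℝ, ∃ η : ℕ → ℝ, Tendsto η atTop (𝓝 0) ∧ ∃ L₁ : ℕ, ∀ L : ℕ, L₁ ≤ L →
      LSAssumptionH d L ε K_S (2 * ((d : ℝ) - 4)) K_h (η L) (isingFamily d L) (isingZc d L)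

/-- NAMED FACT — **continuity of the two-point function in the inverse temperature up to the
critical point**: for the spread-out Ising model (`d ≥ 2`, `L ≥ 1`) and every `x`,
`β ↦ G_β(x)` is continuous on `[0, β_c]` — "Since `τ` and `G(x)` are nondecreasing and continuous
in `p ≤ p_c` for the ferromagnetic models" (Sakai 2007, §3.1, sketch proof of Prop. 1.2); this is
clause (iii) of Liu–Slade's Assumption 1.3 for the model. (Left-continuity is elementary from the
monotone volume limit; continuity from the right below `β_c` is the classical consequence of the
decay of correlations, which the source cites as [l80, s80, s05].) PROVED below, Part F
(`spreadOutTwoPoint_continuousOn_beta_holds`: right-Lipschitz increments below `β_c` from the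
integrated Lebowitz inequality and `χ_β < ∞`). [cite: Sakai2007, §3.1 (sketch proof of Proposition 1.2: "τ and G(x) are nondecreasing and continuous in p ≤ p_c")] -/
def spreadOutTwoPoint_continuousOn_beta : Prop :=
  ∀ d L : ℕ, 2 ≤ d → 1 ≤ L → ∀ x : Site d,
    ContinuousOn (fun β => spreadOutTwoPoint d L β x) (Set.Icc 0 (critBeta d L))

/-- NAMED FACT — **the random-walk bound**: "Repeated applications of (4.2) to the
translation-invariant models result in the random-walk bound: `⟨φ_oφ_x⟩_Λ ≤ S_τ(x)` for `Λ ⊂ ℤ^d`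
and `τ ≤ 1`" (Sakai 2007, §4.1, footnote to (4.2), where (4.2) is
`⟨φ_yφ_x⟩_Λ ≤ δ_{y,x} + Σ_{b : b̄ = x} ⟨φ_yφ_{b̲}⟩_Λ τ_b`), hence in the infinite-volume limit
`G_β(x) ≤ S_τ(x)` with `τ = N_L tanh β ≤ 1`; this is clause (iv) of Liu–Slade's Assumption 1.3 for
the model (at `τ = 1`). Stated for `d > 2`, where the series `S_1 = Σ_n D^{*n}` converges
(transience), and `β ≥ 0`. Named fact, not proved here.
[cite: Sakai2007, §4.1, footnote to (4.2) (random-walk bound ⟨φ_oφ_x⟩_Λ ≤ S_τ(x), τ ≤ 1)] -/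
def spreadOutTwoPoint_le_soGreen : Prop :=
  ∀ d L : ℕ, 2 < d → ∀ β : ℝ, 0 ≤ β → isingZ d L β ≤ 1 → ∀ x : Site d,
    spreadOutTwoPoint d L β x ≤ soGreen d L (isingZ d L β) x

/-! ## Part D. Liu–Slade's Assumption 1.3 for the spread-out Ising model — proved, given the
two named facts of Part C for clauses (iii) (continuity) and (iv) -/

/-- `β_c > 0` for `d ≥ 2`, `L ≥ 1` (high and low temperature: the discharged facts of the
reduction file). [cite: Sakai2007, §1.1 (p_c ∈ (0,∞))] -/
theorem critBeta_pos (hd : 2 ≤ d) (hL : 1 ≤ L) : 0 < critBeta d L := by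
  obtain ⟨β₀, hβ₀, hfin₀⟩ := exists_pos_susceptibility_lt_top_holds d L hd hL
  obtain ⟨β₁, hβ₁⟩ := exists_forall_le_susceptibility_eq_top_holds d L hd hL
  exact critBeta_pos_of hβ₁ hβ₀ hfin₀

/-- **`z_c ≥ 1`**, i.e. `N_L tanh β_c ≥ 1` (`d ≥ 2`, `L ≥ 1`): otherwise `φ_{β_c}({0}) = N_L tanh β_c < 1`
and the finite-size criterion would make `χ_{β_c}` finite (the critical point lies above its
random-walk/mean-field value). [cite: LiuSlade2026, Assumption 1.3 (z_c ≥ 1)] [cite: Sakai2007, §3.1 ("bigger than the mean-field critical point 1")] -/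
theorem one_le_isingZc (hd : 2 ≤ d) (hL : 1 ≤ L) : 1 ≤ isingZc d L := by
  by_contra hlt
  rw [not_le] at hlt
  have hpos := critBeta_pos (d := d) (L := L) hd hL
  have hφ : soPhi d L (critBeta d L) {0} < 1 := by
    refine (soPhi_singleton_le hpos.le).trans_lt ?_
    rw [isingZc, isingZ, soCount] at hlt
    rwa [mul_comm]
  have hfin := spreadOutSusceptibility_le_of_soPhi_lt_one hpos.le (Finset.mem_singleton_self 0) hφ
  have htop := spreadOutSusceptibility_critBeta_eq_top (d := d) (L := L) hd hL
  exact absurd (hfin.trans_lt ENNReal.ofReal_lt_top) (by rw [htop]; exact lt_irrefl _)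

/-- The finite-volume two-point functions on boxes are invariant under the signed coordinate
permutations of `ℤ^d` (graph automorphisms of the range-`L` graph fixing `0` and the boxes).
[folklore] -/
theorem boxTwoPoint_signedPerm (π : Equiv.Perm (Fin d)) (ε : Fin d → ℤˣ) (β : ℝ) (n : ℕ)
    (x : Site d) : boxTwoPoint d L β n (Site.signedPerm π ε x) = boxTwoPoint d L β n x := by
  set φ := (Site.signedPerm π ε).toEmbedding with hφ
  have hmap := isingTwoPoint_free_map (G := spreadOutGraph d L) (G' := spreadOutGraph d L) φ
    (Λ := box d n) (fun p _ q _ => spreadOutGraph_adj_signedPerm π ε p q) β 0 0 x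
  have hbox : (box d n).map φ = box d n := by
    ext y
    rw [hφ, Finset.mem_map_equiv, Site.signedPerm_symm, signedPerm_mem_box_iff]
  have h0 : φ 0 = 0 := Site.signedPerm_zero π ε
  rw [hbox, h0] at hmap
  exact hmap

/-- **`G_β` is `ℤ^d`-symmetric** for every `β`. [cite: LiuSlade2026, Assumption 1.3 (ℤ^d-symmetric family)] -/
theorem isZdSymmetric_spreadOutTwoPoint (β : ℝ) : IsZdSymmetric (spreadOutTwoPoint d L β) :=
  fun π ε x => by simp only [spreadOutTwoPoint, boxTwoPoint_signedPerm]

/-- A finite susceptibility makes `G_β` summable (`β ≥ 0`). [folklore] -/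
theorem summable_spreadOutTwoPoint {β : ℝ} (hβ : 0 ≤ β)
    (hχ : spreadOutSusceptibility d L β < ∞) : Summable (spreadOutTwoPoint d L β) := by
  set f : Site d → NNReal := fun x => ⟨spreadOutTwoPoint d L β x, spreadOutTwoPoint_nonneg hβ x⟩
    with hf
  have h : ∑' x, (f x : ℝ≥0∞) ≠ ⊤ := by
    have : (fun x => (f x : ℝ≥0∞)) = fun x => ENNReal.ofReal (spreadOutTwoPoint d L β x) := by
      funext x
      exact (ENNReal.ofReal_eq_coe_nnreal (spreadOutTwoPoint_nonneg hβ x)).symm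
    rw [this]
    exact hχ.ne
  have hs : Summable f := ENNReal.tsum_coe_ne_top_iff_summable.1 h
  have hs' : Summable fun x => (f x : ℝ) := NNReal.summable_coe.2 hs
  exact hs'

/-- **`G_{β_c}` is not summable** (`χ_{β_c} = ∞`; `d ≥ 2`, `L ≥ 1`) — clause (i) of Assumption 1.3.
[cite: LiuSlade2026, Assumption 1.3 (i)] [cite: Sakai2007, §1.1 (χ_p diverges)] -/
theorem not_summable_spreadOutTwoPoint_critBeta (hd : 2 ≤ d) (hL : 1 ≤ L) :
    ¬Summable (spreadOutTwoPoint d L (critBeta d L)) := by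
  intro hs
  have hpos := critBeta_pos (d := d) (L := L) hd hL
  have h := ENNReal.ofReal_tsum_of_nonneg (fun x => spreadOutTwoPoint_nonneg hpos.le x) hs
  have htop := spreadOutSusceptibility_critBeta_eq_top (d := d) (L := L) hd hL
  rw [spreadOutSusceptibility, ← h] at htop
  exact ENNReal.ofReal_ne_top htop

/-- `|x| ≤ d ‖x‖_∞` on `ℤ^d`. [folklore] -/
theorem euclidNorm_le_mul_supNorm (x : Site d) : euclidNorm x ≤ d * Site.supNorm x := by
  refine (euclidNorm_le_sqrt_mul_norm x).trans ?_
  rw [Site.norm_eq_supNorm]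
  refine mul_le_mul_of_nonneg_right ?_ (Nat.cast_nonneg _)
  have hd0 : (0 : ℝ) ≤ d := Nat.cast_nonneg _
  rw [Real.sqrt_le_left hd0]
  rcases Nat.eq_zero_or_pos d with h | h
  · subst h; simp
  · have h1 : (1 : ℝ) ≤ d := by exact_mod_cast h
    nlinarith

/-- **`G_β(x) = o(|x|^{-(d-2)})` below `β_c`** (`d ≥ 2`, `L ≥ 1`, `0 ≤ β < β_c`), from the
exponential decay of the reduction file — clause (ii) of Assumption 1.3.
[cite: LiuSlade2026, Assumption 1.3 (ii)] [cite: Sakai2007, §1.1 (G_p decays exponentially for p < p_c)] -/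
theorem tendsto_spreadOutTwoPoint_mul_rpow (hd : 2 ≤ d) (hL : 1 ≤ L) {β : ℝ} (hβ : 0 ≤ β)
    (hβc : β < critBeta d L) :
    Tendsto (fun x => spreadOutTwoPoint d L β x * euclidNorm x ^ ((d : ℝ) - 2)) cofinite (𝓝 0) := by
  obtain ⟨C, c, hc, hdec⟩ := spreadOutTwoPoint_exp_decay_of_lt_critBeta hd hL hβ hβc
  set n : ℕ := d - 2 with hn
  have hdn : (d : ℝ) - 2 = (n : ℝ) := by rw [hn, Nat.cast_sub hd]; norm_num
  -- the majorant `g(s) = C d^n s^n e^{-cs}` tends to `0` as `s → ∞`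
  set g : ℝ → ℝ := fun s => C * (d : ℝ) ^ n * c⁻¹ ^ n * ((c * s) ^ n * Real.exp (-(c * s))) with hg
  have hg0 : Tendsto g atTop (𝓝 0) := by
    have h1 := (Real.tendsto_pow_mul_exp_neg_atTop_nhds_zero n).comp
      (Filter.tendsto_id.const_mul_atTop hc)
    have h2 := h1.const_mul (C * (d : ℝ) ^ n * c⁻¹ ^ n)
    rw [mul_zero] at h2
    exact h2
  have hsup : Tendsto (fun x : Site d => (Site.supNorm x : ℝ)) cofinite atTop := by
    have h1 : Tendsto (fun x : Site d => ‖x‖) cofinite atTop := by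
      rw [← Filter.cocompact_eq_cofinite (Site d)]
      exact tendsto_norm_cocompact_atTop
    refine h1.congr fun x => ?_
    rw [Site.norm_eq_supNorm]
  have hmaj : Tendsto (fun x : Site d => g (Site.supNorm x)) cofinite (𝓝 0) := hg0.comp hsup
  refine squeeze_zero' (Filter.Eventually.of_forall fun x => ?_) (Filter.Eventually.of_forall fun x => ?_) hmaj
  · exact mul_nonneg (spreadOutTwoPoint_nonneg hβ x) (Real.rpow_nonneg (euclidNorm_nonneg x) _)
  · -- `G(x)|x|^{d-2} ≤ C e^{-c s} (d s)^n = g(s)`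
    have hG := hdec x
    have hs0 : (0 : ℝ) ≤ Site.supNorm x := Nat.cast_nonneg _
    have hpow : euclidNorm x ^ ((d : ℝ) - 2) ≤ ((d : ℝ) * Site.supNorm x) ^ n := by
      rw [hdn, Real.rpow_natCast]
      exact pow_le_pow_left₀ (euclidNorm_nonneg x) (euclidNorm_le_mul_supNorm x) n
    have hC0 : 0 ≤ C * Real.exp (-c * Site.supNorm x) :=
      le_trans (spreadOutTwoPoint_nonneg hβ x) hG
    calc spreadOutTwoPoint d L β x * euclidNorm x ^ ((d : ℝ) - 2)
        ≤ C * Real.exp (-c * Site.supNorm x) * ((d : ℝ) * Site.supNorm x) ^ n :=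
          mul_le_mul hG hpow (Real.rpow_nonneg (euclidNorm_nonneg x) _) hC0
      _ = g (Site.supNorm x) := by
          simp only [hg]
          rw [mul_pow, mul_pow, neg_mul]
          have hcn : c⁻¹ ^ n * c ^ n = 1 := by
            rw [← mul_pow, inv_mul_cancel₀ hc.ne', one_pow]
          calc C * Real.exp (-(c * Site.supNorm x)) * ((d : ℝ) ^ n * (Site.supNorm x : ℝ) ^ n)
              = C * (d : ℝ) ^ n * (c⁻¹ ^ n * c ^ n) *
                  ((Site.supNorm x : ℝ) ^ n * Real.exp (-(c * Site.supNorm x))) := by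
                rw [hcn]; ring
            _ = C * (d : ℝ) ^ n * c⁻¹ ^ n *
                  (c ^ n * (Site.supNorm x : ℝ) ^ n * Real.exp (-(c * Site.supNorm x))) := by ring

/-- **Liu–Slade's Assumption 1.3 for the spread-out Ising family `G_z = G_{β(z)}`, `z_c = N_L tanh β_c`**
(`d > 2` for clause (iv), `d ≥ 2` and `L ≥ 1` throughout), from the tree and the two named
facts `spreadOutTwoPoint_continuousOn_beta` (continuity half of (iii)) and
`spreadOutTwoPoint_le_soGreen` ((iv)): `z_c ≥ 1` (`one_le_isingZc`), `ℤ^d`-symmetry,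
nonnegativity (GKS I), (i) `χ_{β_c} = ∞`, (ii) summability and exponential decay below `β_c`,
(iii) monotonicity (GKS II in `β`, `β(z)` increasing) are theorems.
[cite: LiuSlade2026, Assumption 1.3] [cite: Sakai2007, §1.1 and §3.1] -/
theorem lsAssumptionG_isingFamily (hd : 2 < d) (hL : 1 ≤ L)
    (hcont : spreadOutTwoPoint_continuousOn_beta) (hRW : spreadOutTwoPoint_le_soGreen) :
    LSAssumptionG d L (isingFamily d L) (isingZc d L) := by
  have hd2 : 2 ≤ d := hd.le
  have hd1 : 1 ≤ d := by omega
  have hN : (0 : ℝ) < soCount d L := by exact_mod_cast soCount_pos hd1 hL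
  have hzc1 := one_le_isingZc (d := d) (L := L) hd2 hL
  have hpos := critBeta_pos (d := d) (L := L) hd2 hL
  -- `β(z)` for `z ∈ [1, z_c]`: nonnegative, below `N_L`, and `β(z) ≤ β_c` with equality at `z_c`
  have hβz0 : ∀ z ∈ Set.Icc 1 (isingZc d L), 0 ≤ soBetaOfZ d L z := fun z hz =>
    soBetaOfZ_nonneg (zero_le_one.trans hz.1)
  have hzN : ∀ z ∈ Set.Icc 1 (isingZc d L), z < soCount d L := fun z hz =>
    lt_soCount_of_le_isingZc hd1 hL hz.2
  have hβzc : soBetaOfZ d L (isingZc d L) = critBeta d L := by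
    rw [isingZc, soBetaOfZ_isingZ hd1 hL]
  have hβle : ∀ z ∈ Set.Icc 1 (isingZc d L), soBetaOfZ d L z ≤ critBeta d L := fun z hz => by
    rw [← hβzc]
    exact soBetaOfZ_mono hd1 hL (zero_le_one.trans hz.1) hz.2
      (lt_soCount_of_le_isingZc hd1 hL le_rfl)
  have hβlt : ∀ z ∈ Set.Ico 1 (isingZc d L), soBetaOfZ d L z < critBeta d L := by
    intro z hz
    rw [← hβzc]
    unfold soBetaOfZ
    refine Real.artanh_lt_artanh ?_ ((div_lt_one hN).2 (lt_soCount_of_le_isingZc hd1 hL le_rfl))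
      (div_lt_div_of_pos_right hz.2 hN)
    have : 0 ≤ z / soCount d L := div_nonneg (zero_le_one.trans hz.1) hN.le
    linarith
  refine ⟨hzc1, fun z _ => isZdSymmetric_spreadOutTwoPoint _, fun z hz x => spreadOutTwoPoint_nonneg (hβz0 z hz) x,
    ?_, ?_, ?_, ?_, ?_, ?_⟩
  · -- (i)
    show ¬Summable fun x => spreadOutTwoPoint d L (soBetaOfZ d L (isingZc d L)) x
    rw [hβzc]
    exact not_summable_spreadOutTwoPoint_critBeta hd2 hL
  · -- (ii) summability
    intro z hz
    have hz' : z ∈ Set.Icc 1 (isingZc d L) := ⟨hz.1, hz.2.le⟩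
    obtain ⟨β₀, hβ₀, hfin₀⟩ := exists_pos_susceptibility_lt_top_holds d L hd2 hL
    exact summable_spreadOutTwoPoint (hβz0 z hz')
      (susceptibility_lt_top_of_lt_critBeta ⟨β₀, hβ₀.le, hfin₀⟩ (hβz0 z hz') (hβlt z hz))
  · -- (ii) decay
    intro z hz
    have hz' : z ∈ Set.Icc 1 (isingZc d L) := ⟨hz.1, hz.2.le⟩
    exact tendsto_spreadOutTwoPoint_mul_rpow hd2 hL (hβz0 z hz') (hβlt z hz)
  · -- (iii) monotonicity
    intro x z₁ hz₁ z₂ hz₂ h12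
    exact spreadOutTwoPoint_mono_beta x (hβz0 z₁ hz₁) (hβz0 z₂ hz₂)
      (soBetaOfZ_mono hd1 hL (zero_le_one.trans hz₁.1) h12 (hzN z₂ hz₂))
  · -- (iii) continuity
    intro x
    have hc := hcont d L hd2 hL x
    refine hc.comp ((continuousOn_soBetaOfZ hd1 hL).mono fun z hz => ⟨zero_le_one.trans hz.1, hzN z hz⟩)
      fun z hz => ⟨hβz0 z hz, hβle z hz⟩
  · -- (iv)
    intro x
    have h1N : (1 : ℝ) < soCount d L := one_lt_soCount_real hd1 hL
    have hz1 : isingZ d L (soBetaOfZ d L 1) = 1 := isingZ_soBetaOfZ hd1 hL zero_le_one h1N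
    have h := hRW d L hd (soBetaOfZ d L 1) (soBetaOfZ_nonneg zero_le_one) hz1.le x
    rw [hz1] at h
    exact h

/-! ## Part E. Assembly: Sakai's Theorem 1.3 (spread-out) from the named facts -/

/-- **`Sakai2007_thm13_spreadOut` from the decomposition.** Given `d > 4` and `ε > 0`: take
`ρ = 2(d-4)` (`> (d-8)/2 ∨ 0`), a small `ε' ≤ ε ∧ ε₀ ∧ ε₁`, the constant `K_S` and threshold of
Prop. 1.2 (`LiuSlade2026_prop12_greenBound`), Sakai's verification of Assumption 1.5
(`Sakai2007_isingAssumptionH`, `ρ = 2(d-4)`), Assumption 1.3 (`lsAssumptionG_isingFamily`), and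
apply Theorem 1.7 (`LiuSlade2026_thm17`): for `L` large, `λ(L) ≥ 1/2`, so
`C = λ(L) a_d/σ² > 0`, and the error display with `s = 2 - ε' < ρ ∧ 2 ∧ (ρ - (d-8)/2)` (`d ≥ 5`)
gives `|G_{β_c}(x) - C|x|^{2-d}| ≤ K|x|^{-(d-ε')} ≤ K|x|^{2-d-(ρ∧2)+ε}` for `x ≠ 0`
(`ρ ∧ 2 = 2`, `|x| ≥ 1`). This is the route "Following the model-independent analysis of the lace
expansion in [h05, hhs03], we obtain … Theorem 1.3" with Liu–Slade's deconvolution in place of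
[hhs03]. [cite: Sakai2007, Theorem 1.3 (SO model) and §3.1] [cite: LiuSlade2026, Theorem 1.7, (1.21)–(1.23)] -/
theorem Sakai2007_thm13_spreadOut_of_LS (h0 : LiuSlade2026_prop12_greenBound)
    (h1 : LiuSlade2026_thm17) (h2 : Sakai2007_isingAssumptionH)
    (h3 : spreadOutTwoPoint_continuousOn_beta) (h4 : spreadOutTwoPoint_le_soGreen) :
    Sakai2007_thm13_spreadOut := by
  intro d hd ε hε
  have hd2 : 2 < d := by omega
  have hd1 : 1 ≤ d := by omega
  have hd5 : (5 : ℝ) ≤ d := by exact_mod_cast hd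
  set ρ : ℝ := 2 * ((d : ℝ) - 4) with hρ
  have hρ0 : max (((d : ℝ) - 8) / 2) 0 < ρ := by
    refine max_lt ?_ ?_ <;> rw [hρ] <;> linarith
  obtain ⟨ε₀, hε₀, H1⟩ := h1 d hd ρ hρ0
  obtain ⟨ε₁, hε₁, H2⟩ := h2 d hd
  set ε' : ℝ := min ε (min ε₀ ε₁) with hε'
  have hε'0 : 0 < ε' := lt_min hε (lt_min hε₀ hε₁)
  have hε'ε : ε' ≤ ε := min_le_left _ _
  have hε'0' : ε' ≤ ε₀ := (min_le_right _ _).trans (min_le_left _ _)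
  have hε'1 : ε' ≤ ε₁ := (min_le_right _ _).trans (min_le_right _ _)
  obtain ⟨K_S, hKS, L₀, hS⟩ := h0 d hd2 ε' hε'0
  obtain ⟨K_h, η, hη, L₁, hH⟩ := H2 ε' hε'0 hε'1 K_S hKS
  obtain ⟨L₂, lam, hlam, hmain⟩ := H1 ε' hε'0 hε'0' K_S hKS ⟨L₀, hS⟩ (fun L => isingFamily d L)
    (fun L => isingZc d L) K_h η hη
    ⟨max L₁ 1, fun L hL =>
      ⟨lsAssumptionG_isingFamily hd2 (le_of_max_le_right hL) h3 h4, hH L (le_of_max_le_left hL)⟩⟩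
  obtain ⟨Kl, hKl⟩ := hlam 1 one_pos
  refine ⟨max L₂ (max 1 (⌈2 * |Kl|⌉₊ + 1)), fun L hL => ?_⟩
  have hL2 : L₂ ≤ L := le_of_max_le_left hL
  have hL1 : 1 ≤ L := (le_max_left _ _).trans (le_of_max_le_right hL)
  have hLK : ⌈2 * |Kl|⌉₊ + 1 ≤ L := (le_max_right _ _).trans (le_of_max_le_right hL)
  obtain ⟨hlim, herr⟩ := hmain L hL2
  -- `λ(L) ≥ 1/2`
  have hLpos : (0 : ℝ) < L := by exact_mod_cast hL1
  have hlamL : 1 / 2 ≤ lam L := by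
    have h := hKl L hL2
    have hrpow : (L : ℝ) ^ (-(2 - 1 : ℝ)) = (L : ℝ)⁻¹ := by norm_num [Real.rpow_neg_one]
    rw [hrpow] at h
    have hKL : 2 * |Kl| < L := by
      have h1 : (⌈2 * |Kl|⌉₊ : ℝ) < L := by exact_mod_cast hLK
      exact (Nat.le_ceil _).trans_lt h1
    have hb : Kl * (L : ℝ)⁻¹ ≤ 1 / 2 := by
      rw [← div_eq_mul_inv, div_le_iff₀ hLpos]
      linarith [le_abs_self Kl]
    have := (abs_sub_le_iff.1 (h.trans hb)).2
    linarith
  have hσ : 0 < soVariance d L := soVariance_pos hd1 hL1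
  have ha : 0 < gaussianAmp d := gaussianAmp_pos (by omega)
  have hlam0 : 0 < lam L := by linarith
  set C : ℝ := lam L * gaussianAmp d / soVariance d L with hC
  have hCpos : 0 < C := by positivity
  -- the error display with `s = 2 - ε'`
  have hs : (2 - ε' : ℝ) < min (min ρ 2) (ρ - ((d : ℝ) - 8) / 2) := by
    rw [lt_min_iff, lt_min_iff]
    refine ⟨⟨?_, ?_⟩, ?_⟩ <;> (try rw [hρ]) <;> linarith
  obtain ⟨K, hK⟩ := herr (2 - ε') hs
  have hK0 : 0 ≤ K := by
    have h := hK 0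
    rw [jnorm, show euclidNorm (0 : Site d) = 0 by simp [euclidNorm], max_eq_right zero_le_one,
      Real.one_rpow, Real.one_rpow, div_one] at h
    exact (abs_nonneg _).trans h
  refine ⟨C, K, hCpos, fun x hx => ?_⟩
  have hxK := hK x
  rw [isingFamily_isingZc hd1 hL1] at hxK
  have hx1 : 1 ≤ euclidNorm x := one_le_euclidNorm_of_ne_zero hx
  have hr0 : 0 < euclidNorm x := by linarith
  rw [jnorm_eq_euclidNorm hx1] at hxK
  have hmin : min (2 * ((d : ℝ) - 4)) 2 = 2 := min_eq_right (by linarith)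
  rw [hmin]
  have hlhs : C * euclidNorm x ^ ((2 : ℝ) - d) =
      lam L * gaussianAmp d / (soVariance d L * euclidNorm x ^ ((d : ℝ) - 2)) := by
    have h1 : euclidNorm x ^ ((d : ℝ) - 2) ≠ 0 := (Real.rpow_pos_of_pos hr0 _).ne'
    have h2 : soVariance d L ≠ 0 := hσ.ne'
    rw [hC, show (2 : ℝ) - d = -((d : ℝ) - 2) by ring, Real.rpow_neg hr0.le]
    field_simp
  rw [hlhs]
  refine hxK.trans ?_
  rw [div_eq_mul_inv, ← Real.rpow_neg hr0.le]
  refine mul_le_mul_of_nonneg_left ?_ hK0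
  refine Real.rpow_le_rpow_of_exponent_le hx1 ?_
  linarith

/-! ## Part F. Continuity of `G_β(x)` in `β ≤ β_c`: discharge of `spreadOutTwoPoint_continuousOn_beta` -/

/-- **Right increments of `G_β(x)` are Lipschitz while the susceptibility is finite**: for
`0 ≤ β₀ ≤ β ≤ β₁` with `χ_{β₁} < ∞`,  `G_β(x) ≤ G_{β₀}(x) + (β - β₀) · |J| · χ_{β₁}` (`|J| = N_L`),
from the increment bound `G_β(x) ≤ G_{β₀}(x) + (β - β₀) Σ_u Σ_{v∼u} G_β(u) G_β(v - x)` of the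
proofs file (integrated Lebowitz inequality) with `G ≤ 1` and `Σ_u G_β(u) = χ_β ≤ χ_{β₁}`.
[cite: DuminilCopinICM2022, §7.1 (∂_β of correlations bounded by 2dχ-type sums)] [cite: Sakai2007, §3.1 ("G(x) … continuous in p ≤ p_c")] -/
theorem spreadOutTwoPoint_le_add_mul_susceptibility {β₀ β β₁ : ℝ} (h0 : 0 ≤ β₀) (h01 : β₀ ≤ β)
    (h1 : β ≤ β₁) (hχ : spreadOutSusceptibility d L β₁ < ∞) (x : Site d) :
    spreadOutTwoPoint d L β x ≤ spreadOutTwoPoint d L β₀ x +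
      (β - β₀) * ((spreadOutGraph d L).degree 0 * (spreadOutSusceptibility d L β₁).toReal) := by
  have hβ : 0 ≤ β := h0.trans h01
  have hβ₁ : 0 ≤ β₁ := hβ.trans h1
  have hincr := ofReal_spreadOutTwoPoint_le_add (d := d) (L := L) h0 h01 x
  set D : ℕ := (spreadOutGraph d L).degree 0 with hD
  -- the kernel is at most `|J| χ_β ≤ |J| χ_{β₁}`
  have hker : ∑' u : Site d, ∑ v ∈ (spreadOutGraph d L).neighborFinset u,
      ENNReal.ofReal (spreadOutTwoPoint d L β u) *
        ENNReal.ofReal (spreadOutTwoPoint d L β (v - x)) ≤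
      (D : ℝ≥0∞) * spreadOutSusceptibility d L β₁ := by
    calc ∑' u : Site d, ∑ v ∈ (spreadOutGraph d L).neighborFinset u,
          ENNReal.ofReal (spreadOutTwoPoint d L β u) *
            ENNReal.ofReal (spreadOutTwoPoint d L β (v - x))
        ≤ ∑' u : Site d, ∑ _v ∈ (spreadOutGraph d L).neighborFinset u,
            ENNReal.ofReal (spreadOutTwoPoint d L β u) := by
          refine ENNReal.tsum_le_tsum fun u => Finset.sum_le_sum fun v _ => ?_
          calc ENNReal.ofReal (spreadOutTwoPoint d L β u) *
                ENNReal.ofReal (spreadOutTwoPoint d L β (v - x))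
              ≤ ENNReal.ofReal (spreadOutTwoPoint d L β u) * 1 :=
                mul_le_mul' le_rfl (ENNReal.ofReal_le_one.2 (spreadOutTwoPoint_le_one β _))
            _ = _ := mul_one _
      _ = ∑' u : Site d, (D : ℝ≥0∞) * ENNReal.ofReal (spreadOutTwoPoint d L β u) := by
          refine tsum_congr fun u => ?_
          rw [Finset.sum_const, card_neighborFinset_spreadOutGraph, nsmul_eq_mul]
      _ = (D : ℝ≥0∞) * spreadOutSusceptibility d L β := ENNReal.tsum_mul_left
      _ ≤ (D : ℝ≥0∞) * spreadOutSusceptibility d L β₁ :=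
          mul_le_mul' le_rfl (susceptibility_mono hβ hβ₁ h1)
  have hχβ₁ : (D : ℝ≥0∞) * spreadOutSusceptibility d L β₁ ≠ ⊤ :=
    ENNReal.mul_ne_top (ENNReal.natCast_ne_top D) hχ.ne
  have hbound : ENNReal.ofReal (spreadOutTwoPoint d L β x) ≤
      ENNReal.ofReal (spreadOutTwoPoint d L β₀ x) +
        ENNReal.ofReal (β - β₀) * ((D : ℝ≥0∞) * spreadOutSusceptibility d L β₁) :=
    hincr.trans (add_le_add le_rfl (mul_le_mul' le_rfl hker))
  have hrhs_ne_top : ENNReal.ofReal (spreadOutTwoPoint d L β₀ x) +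
      ENNReal.ofReal (β - β₀) * ((D : ℝ≥0∞) * spreadOutSusceptibility d L β₁) ≠ ⊤ :=
    ENNReal.add_ne_top.2 ⟨ENNReal.ofReal_ne_top, ENNReal.mul_ne_top ENNReal.ofReal_ne_top hχβ₁⟩
  have h := (ENNReal.ofReal_le_iff_le_toReal hrhs_ne_top).1 hbound
  rw [ENNReal.toReal_add ENNReal.ofReal_ne_top (ENNReal.mul_ne_top ENNReal.ofReal_ne_top hχβ₁),
    ENNReal.toReal_ofReal (spreadOutTwoPoint_nonneg h0 x), ENNReal.toReal_mul,
    ENNReal.toReal_ofReal (sub_nonneg.2 h01), ENNReal.toReal_mul, ENNReal.toReal_natCast] at h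
  exact h

/-- **Discharge of the named fact `spreadOutTwoPoint_continuousOn_beta`**: for `d ≥ 2`, `L ≥ 1`
and every `x`, `β ↦ G_β(x)` is continuous on `[0, β_c]` — "τ and `G(x)` are nondecreasing and
continuous in `p ≤ p_c` for the ferromagnetic models" (Sakai 2007, §3.1). Proof: `G_·(x)` is
nondecreasing (GKS II); it is left-continuous at every `β₀ > 0` as the supremum of the continuous
nondecreasing finite-volume two-point functions (`spreadOutTwoPoint_le_of_forall_lt`); and for
`β₀ < β_c` it is right-Lipschitz (`spreadOutTwoPoint_le_add_mul_susceptibility` with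
`β₁ = (β₀ + β_c)/2`, `χ_{β₁} < ∞`). [cite: Sakai2007, §3.1 (sketch proof of Proposition 1.2: "τ and G(x) are nondecreasing and continuous in p ≤ p_c")] -/
theorem spreadOutTwoPoint_continuousOn_beta_holds : spreadOutTwoPoint_continuousOn_beta := by
  intro d L hd hL x
  rw [Metric.continuousOn_iff]
  intro β₀ hβ₀ ε hε
  obtain ⟨hβ₀0, hβ₀c⟩ := hβ₀
  set f : ℝ → ℝ := fun β => spreadOutTwoPoint d L β x with hf
  have hmono : MonotoneOn f (Set.Ici 0) := spreadOutTwoPoint_mono_beta x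
  have hne : {β : ℝ | 0 ≤ β ∧ spreadOutSusceptibility d L β < ∞}.Nonempty := by
    obtain ⟨β', hβ', hfin'⟩ := exists_pos_susceptibility_lt_top_holds d L hd hL
    exact ⟨β', hβ'.le, hfin'⟩
  -- (a) a left threshold `βl < β₀` with `f β₀ - ε/2 < f βl` (when `β₀ > 0`)
  have hleft : ∃ δl : ℝ, 0 < δl ∧ ∀ β : ℝ, 0 ≤ β → β < β₀ → β₀ - β < δl → f β₀ - ε < f β := by
    rcases eq_or_lt_of_le hβ₀0 with h0 | h0
    · exact ⟨1, one_pos, fun β hβ hββ₀ _ => absurd (h0 ▸ hββ₀) (not_lt.2 hβ)⟩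
    · -- by lower semicontinuity some `β' < β₀` has `f β' > f β₀ - ε/2`
      have hex : ∃ β' : ℝ, 0 ≤ β' ∧ β' < β₀ ∧ f β₀ - ε < f β' := by
        by_contra hcon
        push Not at hcon
        have hle : f β₀ ≤ f β₀ - ε :=
          spreadOutTwoPoint_le_of_forall_lt h0 fun β' hβ' hlt => hcon β' hβ' hlt
        linarith
      obtain ⟨β', hβ'0, hβ'lt, hfβ'⟩ := hex
      refine ⟨β₀ - β', sub_pos.2 hβ'lt, fun β hβ hββ₀ hdist => ?_⟩
      have hβ'β : β' ≤ β := by linarith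
      exact hfβ'.trans_le (hmono hβ'0 hβ hβ'β)
  -- (b) a right threshold from the Lipschitz bound (when `β₀ < β_c`)
  have hright : ∃ δr : ℝ, 0 < δr ∧ ∀ β : ℝ, β ≤ critBeta d L → β₀ < β → β - β₀ < δr →
      f β < f β₀ + ε := by
    rcases eq_or_lt_of_le hβ₀c with hc | hc
    · exact ⟨1, one_pos, fun β hβ hββ₀ _ => absurd (hc ▸ hββ₀) (not_lt.2 hβ)⟩
    · set β₁ : ℝ := (β₀ + critBeta d L) / 2 with hβ₁
      have hβ₁0 : 0 ≤ β₁ := by rw [hβ₁]; linarith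
      have hβ₁c : β₁ < critBeta d L := by rw [hβ₁]; linarith
      have hχ : spreadOutSusceptibility d L β₁ < ∞ :=
        susceptibility_lt_top_of_lt_critBeta hne hβ₁0 hβ₁c
      set K : ℝ := (spreadOutGraph d L).degree 0 * (spreadOutSusceptibility d L β₁).toReal with hK
      have hK0 : 0 ≤ K := mul_nonneg (Nat.cast_nonneg _) ENNReal.toReal_nonneg
      refine ⟨min (β₁ - β₀) (ε / (K + 1)), lt_min (by rw [hβ₁]; linarith) (by positivity),
        fun β _ hββ₀ hdist => ?_⟩
      have hββ₁ : β ≤ β₁ := by linarith [min_le_left (β₁ - β₀) (ε / (K + 1))]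
      have hinc := spreadOutTwoPoint_le_add_mul_susceptibility (d := d) (L := L) hβ₀0 hββ₀.le hββ₁ hχ x
      have hd' : β - β₀ < ε / (K + 1) := hdist.trans_le (min_le_right _ _)
      have hKε : (β - β₀) * K < ε := by
        have h1 : (β - β₀) * K ≤ (β - β₀) * (K + 1) :=
          mul_le_mul_of_nonneg_left (by linarith) (sub_nonneg.2 hββ₀.le)
        have h2 : (β - β₀) * (K + 1) < ε := by
          rwa [← lt_div_iff₀ (by positivity)]
        linarith
      calc f β ≤ f β₀ + (β - β₀) * K := hinc
        _ < f β₀ + ε := by linarith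
  obtain ⟨δl, hδl, hl⟩ := hleft
  obtain ⟨δr, hδr, hr⟩ := hright
  refine ⟨min δl δr, lt_min hδl hδr, fun β hβ hdist => ?_⟩
  obtain ⟨hβ0, hβc⟩ := hβ
  rw [Real.dist_eq] at hdist ⊢
  rcases lt_trichotomy β β₀ with hlt | rfl | hgt
  · have h1 : β₀ - β < δl := by
      have := (abs_sub_lt_iff.1 hdist).2
      linarith [min_le_left δl δr]
    have hfl := hl β hβ0 hlt h1
    have hfm : f β ≤ f β₀ := hmono hβ0 hβ₀0 hlt.le
    rw [abs_sub_lt_iff]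
    constructor <;> linarith
  · simpa using hε
  · have h1 : β - β₀ < δr := by
      have := (abs_sub_lt_iff.1 hdist).1
      linarith [min_le_right δl δr]
    have hfr := hr β hβc hgt h1
    have hfm : f β₀ ≤ f β := hmono hβ₀0 hβ0 hgt.le
    rw [abs_sub_lt_iff]
    constructor <;> linarith

/-- **Assumption 1.3 for the Ising family with the continuity clause discharged**: only the
random-walk bound `spreadOutTwoPoint_le_soGreen` remains as an input.
[cite: LiuSlade2026, Assumption 1.3] [cite: Sakai2007, §3.1 and §4.1 (footnote)] -/
theorem lsAssumptionG_isingFamily' (hd : 2 < d) (hL : 1 ≤ L)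
    (hRW : spreadOutTwoPoint_le_soGreen) : LSAssumptionG d L (isingFamily d L) (isingZc d L) :=
  lsAssumptionG_isingFamily hd hL spreadOutTwoPoint_continuousOn_beta_holds hRW

/-- **`Sakai2007_thm13_spreadOut` from four named facts** (the continuity fact being proved):
Liu–Slade's Prop. 1.2 and Thm. 1.7, Sakai's lace expansion with diagrammatic bounds
(Assumption 1.5), and the random-walk bound. [cite: Sakai2007, Theorem 1.3 (SO model)] [cite: LiuSlade2026, Theorem 1.7] -/
theorem Sakai2007_thm13_spreadOut_of_LS' (h0 : LiuSlade2026_prop12_greenBound)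
    (h1 : LiuSlade2026_thm17) (h2 : Sakai2007_isingAssumptionH)
    (h4 : spreadOutTwoPoint_le_soGreen) : Sakai2007_thm13_spreadOut :=
  Sakai2007_thm13_spreadOut_of_LS h0 h1 h2 spreadOutTwoPoint_continuousOn_beta_holds h4


/-! ## Part G. Theorem 1.7 with the `λ`-clause at the fixed `ε`: the corrected transcription
`LiuSlade2026_thm1_7` (supersedes `LiuSlade2026_thm17`) -/

/-- NAMED FACT — **Liu–Slade 2026, Theorem 1.7 with its error display (1.21)**, CORRECTED
transcription, superseding `LiuSlade2026_thm17` above. The printed theorem: "Let `d > 4`. Under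
Assumption 1.3, together with either Assumption 1.4 or Assumption 1.5, there is an `L₂` such that
for all `L ≥ L₂`, `G_{z_c}(x) ∼ (λ_{z_c}/σ²) a_d/|x|^{d-2}` as `|x| → ∞`, where `a_d` is the
constant of (1.8), and, for any fixed `ε > 0`, `λ_{z_c} = 1 + O(L^{-2+ε})`", followed by (1.21):
"`G_{z_c}(x) = (λ_{z_c}/σ²) a_d/⟦x⟧^{d-2} + O_L(1)/⟦x⟧^{d-2+s}` with any
`s < ρ ∧ 2 ∧ (ρ - (d-8)/2)`" (from Liu–Slade 2024, Thm. 1.2, once `b(z_c) ≤ 2`).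

**The discrepancy.** The `ε` of the theorem is the one fixed once and for all in §1.2.2 ("Let
`d > 2`, fix a small `ε > 0`, and let `K_S = K_S(ε)` be the constant in the bound (1.10)"): it
enters the bootstrap function `b(z)` of (1.12) and the bounds `K_Π L^{-2+ε}`, `K_h L^{-2+ε}` of
Assumptions 1.4–1.5, and the printed proof (§2.2: "By (2.6), `λ_{z_c} = 1 + O(β)`", with
`β = const · L^{-2+ε}`) yields `λ_{z_c} = 1 + O(L^{-2+ε})` for THAT `ε` and nothing smaller.
`LiuSlade2026_thm17` fixes `ε` in its hypotheses (`LSAssumptionH d L ε K_S ρ …`) but concludes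
`|λ(L) - 1| ≤ K L^{-(2-ε')}` for EVERY `ε' > 0`, which does not follow and is in fact false as
stated: for `z_c(L) = 1 + L^{-2+ε}` the family `G_z = S_{z/z_c}/z_c` (with `h_z = δ/z_c`,
`K_h = 1`, `o(1) ≡ 0`) satisfies Assumptions 1.3 and 1.5 at level `ε`, its `λ(L)` is forced to be
`1/z_c(L)` by the asymptotics `S_1(x)|x|^{d-2} → a_d/σ²` ((1.11)), and
`|λ(L) - 1| ≥ L^{-2+ε}/2` defeats every `K L^{-(2-ε/2)}`. This declaration is `LiuSlade2026_thm17`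
verbatim except that the first conclusion clause is stated at the fixed `ε`:
`∃ K, ∀ L ≥ L₂, |λ(L) - 1| ≤ K L^{-(2-ε)}`. (`LiuSlade2026_thm1_7_of_thm17` records that the old
statement implies this one; the assembly `Sakai2007_thm13_spreadOut_of_thm1_7` below re-threads
Sakai's Theorem 1.3 through it.)

Transcription choices otherwise as in `LiuSlade2026_thm17` (conservative): the data are an
`L`-indexed sequence of real-valued (finite) families `G^{(L)}_z` with critical values `z_c(L)`
(the assumptions' constants uniform in `L`, their `o(1)` a sequence `η_L → 0`); "fix a small
`ε > 0`" is `∃ ε₀ > 0, ∀ ε ∈ (0, ε₀]`; `K_S` is any positive constant for which (1.10) holds for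
all large `L`; `L₂` is chosen after the family (weaker than the printed uniformity); `f ∼ g` with
`g = c|x|^{2-d}`, `c ≠ 0`, is `f(x)|x|^{d-2} → c` along the cofinite filter; `a_d = gaussianAmp d`,
`σ² = soVariance d L`, `⟦x⟧ = jnorm x`. Pure analysis (§§2–4 and Appendix A of the source, with
Liu–Slade 2024, Thm. 1.2, for (1.21)); named fact, not proved here.
[cite: LiuSlade2026, Theorem 1.7 and (1.21); §1.2.2 ("fix a small ε > 0") and §2.2 (λ_{z_c} = 1 + O(β))]
[cite: LiuSlade2024, Theorem 1.2] -/
def LiuSlade2026_thm1_7 : Prop :=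
  ∀ d : ℕ, 4 < d → ∀ ρ : ℝ, max (((d : ℝ) - 8) / 2) 0 < ρ →
    ∃ ε₀ : ℝ, 0 < ε₀ ∧ ∀ ε : ℝ, 0 < ε → ε ≤ ε₀ → ∀ K_S : ℝ, 0 < K_S →
      (∃ L₀ : ℕ, ∀ L : ℕ, L₀ ≤ L → ∀ x : Site d, soGreen d L 1 x ≤
          delta0 x + K_S * (L : ℝ) ^ (-(2 - ε)) * jnorm x ^ (-((d : ℝ) - 2))) →
      ∀ (G : ℕ → ℝ → Site d → ℝ) (zc : ℕ → ℝ) (K_h : ℝ) (η : ℕ → ℝ),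
        Tendsto η atTop (𝓝 0) →
        (∃ L₁ : ℕ, ∀ L : ℕ, L₁ ≤ L →
            LSAssumptionG d L (G L) (zc L) ∧ LSAssumptionH d L ε K_S ρ K_h (η L) (G L) (zc L)) →
        ∃ L₂ : ℕ, ∃ lam : ℕ → ℝ,
          (∃ K : ℝ, ∀ L : ℕ, L₂ ≤ L → |lam L - 1| ≤ K * (L : ℝ) ^ (-(2 - ε))) ∧
          ∀ L : ℕ, L₂ ≤ L →
            Tendsto (fun x : Site d => G L (zc L) x * euclidNorm x ^ ((d : ℝ) - 2)) cofinite
                (𝓝 (lam L * gaussianAmp d / soVariance d L)) ∧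
            ∀ s : ℝ, s < min (min ρ 2) (ρ - ((d : ℝ) - 8) / 2) → ∃ K : ℝ, ∀ x : Site d,
              |G L (zc L) x - lam L * gaussianAmp d / (soVariance d L * jnorm x ^ ((d : ℝ) - 2))| ≤
                K / jnorm x ^ ((d : ℝ) - 2 + s)

/-- The over-strong transcription `LiuSlade2026_thm17` implies the corrected one (take `ε' = ε`
in its `λ`-clause): `LiuSlade2026_thm1_7` weakens exactly that clause and nothing else.
[cite: LiuSlade2026, Theorem 1.7] -/
theorem LiuSlade2026_thm1_7_of_thm17 (h : LiuSlade2026_thm17) : LiuSlade2026_thm1_7 := by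
  intro d hd ρ hρ
  obtain ⟨ε₀, hε₀, H⟩ := h d hd ρ hρ
  refine ⟨ε₀, hε₀, fun ε hε hεε₀ K_S hKS hS G zc K_h η hη hA => ?_⟩
  obtain ⟨L₂, lam, hlam, hmain⟩ := H ε hε hεε₀ K_S hKS hS G zc K_h η hη hA
  exact ⟨L₂, lam, hlam ε hε, hmain⟩

/-- **`Sakai2007_thm13_spreadOut` from the decomposition, through the corrected Theorem 1.7.**
As `Sakai2007_thm13_spreadOut_of_LS`, with `LiuSlade2026_thm1_7` in place of
`LiuSlade2026_thm17`: given `d > 4` and `ε > 0`, take `ρ = 2(d-4)`, a small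
`ε' ≤ ε ∧ ε₀ ∧ ε₁ ∧ 1`, the constant `K_S` and threshold of Prop. 1.2, Sakai's verification of
Assumption 1.5, Assumption 1.3 (`lsAssumptionG_isingFamily`), and apply Theorem 1.7: since
`ε' ≤ 1`, `|λ(L) - 1| ≤ K L^{-(2-ε')} ≤ |K|/L ≤ 1/2` for `L ≥ 2|K|`, so `C = λ(L) a_d/σ² > 0`, and
the error display with `s = 2 - ε'` gives the claim. [cite: Sakai2007, Theorem 1.3 (SO model) and §3.1] [cite: LiuSlade2026, Theorem 1.7, (1.21)–(1.23)] -/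
theorem Sakai2007_thm13_spreadOut_of_thm1_7 (h0 : LiuSlade2026_prop12_greenBound)
    (h1 : LiuSlade2026_thm1_7) (h2 : Sakai2007_isingAssumptionH)
    (h3 : spreadOutTwoPoint_continuousOn_beta) (h4 : spreadOutTwoPoint_le_soGreen) :
    Sakai2007_thm13_spreadOut := by
  intro d hd ε hε
  have hd2 : 2 < d := by omega
  have hd1 : 1 ≤ d := by omega
  have hd5 : (5 : ℝ) ≤ d := by exact_mod_cast hd
  set ρ : ℝ := 2 * ((d : ℝ) - 4) with hρ
  have hρ0 : max (((d : ℝ) - 8) / 2) 0 < ρ := by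
    refine max_lt ?_ ?_ <;> rw [hρ] <;> linarith
  obtain ⟨ε₀, hε₀, H1⟩ := h1 d hd ρ hρ0
  obtain ⟨ε₁, hε₁, H2⟩ := h2 d hd
  set ε' : ℝ := min ε (min ε₀ (min ε₁ 1)) with hε'
  have hε'0 : 0 < ε' := lt_min hε (lt_min hε₀ (lt_min hε₁ one_pos))
  have hε'ε : ε' ≤ ε := min_le_left _ _
  have hε'0' : ε' ≤ ε₀ := (min_le_right _ _).trans (min_le_left _ _)
  have hε'1 : ε' ≤ ε₁ := (min_le_right _ _).trans ((min_le_right _ _).trans (min_le_left _ _))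
  have hε'one : ε' ≤ 1 :=
    (min_le_right _ _).trans ((min_le_right _ _).trans (min_le_right _ _))
  obtain ⟨K_S, hKS, L₀, hS⟩ := h0 d hd2 ε' hε'0
  obtain ⟨K_h, η, hη, L₁, hH⟩ := H2 ε' hε'0 hε'1 K_S hKS
  obtain ⟨L₂, lam, hlam, hmain⟩ := H1 ε' hε'0 hε'0' K_S hKS ⟨L₀, hS⟩ (fun L => isingFamily d L)
    (fun L => isingZc d L) K_h η hη
    ⟨max L₁ 1, fun L hL =>
      ⟨lsAssumptionG_isingFamily hd2 (le_of_max_le_right hL) h3 h4, hH L (le_of_max_le_left hL)⟩⟩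
  obtain ⟨Kl, hKl⟩ := hlam
  refine ⟨max L₂ (max 1 (⌈2 * |Kl|⌉₊ + 1)), fun L hL => ?_⟩
  have hL2 : L₂ ≤ L := le_of_max_le_left hL
  have hL1 : 1 ≤ L := (le_max_left _ _).trans (le_of_max_le_right hL)
  have hLK : ⌈2 * |Kl|⌉₊ + 1 ≤ L := (le_max_right _ _).trans (le_of_max_le_right hL)
  obtain ⟨hlim, herr⟩ := hmain L hL2
  -- `λ(L) ≥ 1/2`
  have hLpos : (0 : ℝ) < L := by exact_mod_cast hL1
  have hL1' : (1 : ℝ) ≤ L := by exact_mod_cast hL1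
  have hlamL : 1 / 2 ≤ lam L := by
    have h := hKl L hL2
    have hrpow : (L : ℝ) ^ (-(2 - ε')) ≤ (L : ℝ)⁻¹ := by
      rw [← Real.rpow_neg_one]
      exact Real.rpow_le_rpow_of_exponent_le hL1' (by linarith)
    have hrpow0 : 0 ≤ (L : ℝ) ^ (-(2 - ε')) := Real.rpow_nonneg hLpos.le _
    have hKL : 2 * |Kl| < L := by
      have h1 : (⌈2 * |Kl|⌉₊ : ℝ) < L := by exact_mod_cast hLK
      exact (Nat.le_ceil _).trans_lt h1
    have hb : Kl * (L : ℝ) ^ (-(2 - ε')) ≤ 1 / 2 := by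
      calc Kl * (L : ℝ) ^ (-(2 - ε')) ≤ |Kl| * (L : ℝ)⁻¹ :=
            (mul_le_mul_of_nonneg_right (le_abs_self Kl) hrpow0).trans
              (mul_le_mul_of_nonneg_left hrpow (abs_nonneg Kl))
        _ ≤ 1 / 2 := by
            rw [← div_eq_mul_inv, div_le_iff₀ hLpos]
            linarith
    have := (abs_sub_le_iff.1 (h.trans hb)).2
    linarith
  have hσ : 0 < soVariance d L := soVariance_pos hd1 hL1
  have ha : 0 < gaussianAmp d := gaussianAmp_pos (by omega)
  have hlam0 : 0 < lam L := by linarith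
  set C : ℝ := lam L * gaussianAmp d / soVariance d L with hC
  have hCpos : 0 < C := by positivity
  -- the error display with `s = 2 - ε'`
  have hs : (2 - ε' : ℝ) < min (min ρ 2) (ρ - ((d : ℝ) - 8) / 2) := by
    rw [lt_min_iff, lt_min_iff]
    refine ⟨⟨?_, ?_⟩, ?_⟩ <;> (try rw [hρ]) <;> linarith
  obtain ⟨K, hK⟩ := herr (2 - ε') hs
  have hK0 : 0 ≤ K := by
    have h := hK 0
    rw [jnorm, show euclidNorm (0 : Site d) = 0 by simp [euclidNorm], max_eq_right zero_le_one,
      Real.one_rpow, Real.one_rpow, div_one] at h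
    exact (abs_nonneg _).trans h
  refine ⟨C, K, hCpos, fun x hx => ?_⟩
  have hxK := hK x
  rw [isingFamily_isingZc hd1 hL1] at hxK
  have hx1 : 1 ≤ euclidNorm x := one_le_euclidNorm_of_ne_zero hx
  have hr0 : 0 < euclidNorm x := by linarith
  rw [jnorm_eq_euclidNorm hx1] at hxK
  have hmin : min (2 * ((d : ℝ) - 4)) 2 = 2 := min_eq_right (by linarith)
  rw [hmin]
  have hlhs : C * euclidNorm x ^ ((2 : ℝ) - d) =
      lam L * gaussianAmp d / (soVariance d L * euclidNorm x ^ ((d : ℝ) - 2)) := by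
    have h1 : euclidNorm x ^ ((d : ℝ) - 2) ≠ 0 := (Real.rpow_pos_of_pos hr0 _).ne'
    have h2 : soVariance d L ≠ 0 := hσ.ne'
    rw [hC, show (2 : ℝ) - d = -((d : ℝ) - 2) by ring, Real.rpow_neg hr0.le]
    field_simp
  rw [hlhs]
  refine hxK.trans ?_
  rw [div_eq_mul_inv, ← Real.rpow_neg hr0.le]
  refine mul_le_mul_of_nonneg_left ?_ hK0
  refine Real.rpow_le_rpow_of_exponent_le hx1 ?_
  linarith

/-- **`Sakai2007_thm13_spreadOut` from four named facts, through the corrected Theorem 1.7**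
(the continuity fact being proved, Part F): Liu–Slade's Prop. 1.2 and Thm. 1.7
(`LiuSlade2026_thm1_7`), Sakai's lace expansion with diagrammatic bounds (Assumption 1.5), and
the random-walk bound. [cite: Sakai2007, Theorem 1.3 (SO model)] [cite: LiuSlade2026, Theorem 1.7] -/
theorem Sakai2007_thm13_spreadOut_of_thm1_7' (h0 : LiuSlade2026_prop12_greenBound)
    (h1 : LiuSlade2026_thm1_7) (h2 : Sakai2007_isingAssumptionH)
    (h4 : spreadOutTwoPoint_le_soGreen) : Sakai2007_thm13_spreadOut :=
  Sakai2007_thm13_spreadOut_of_thm1_7 h0 h1 h2 spreadOutTwoPoint_continuousOn_beta_holds h4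

end Literature.Barriers.CriticalPhenomena.SpreadOutIsing

end
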